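import Literature.MathematicalPhysics.QuantumFieldTheory.Balaban1983to89.B13Term214Centred

/-!
# `Balaban1983to89.B13Bound226Centred` — T. Bałaban, *Renormalization group approach to lattice gauge field theories. II.
Cluster expansions*, Commun. Math. Phys. **116** (1988) 1–22 [Balaban1988RG2Cluster], pp. 15–17, with [Balaban1987RG1]
(2.10)–(2.13) pp. 266–268: the chain (2.15) → (2.16) → (2.23) → (2.26) run on the CENTRED integrand of the generic term
(2.14) — the difference of the term at two last lines `F214(𝐕)`, `F214(𝐕₀)` whose first-order discrepancy is ODD in the
field — pointwise on the parameter polydiscs from the entrywise (2.16)-letters (located geometry), and assembled on the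
two-scale torus ALONG THE WINDOW-DILATED FAMILY of `B13Term214WindowDilated` (complex last coupling `u`, member `b = s₀/u`):
the per-term CENTRED letter `‖(2.14)_b(𝐕) − (2.14)_b(𝐕₀)‖ ≤ s²·weight·e^{a₅|Z|}` — the shape of node N22's (S-vertex-T′) —
from the primitive letters at `b = 1`, the parity data and the second-order Taylor letters of the potentials

statement-level skeleton of published theorems with citation tags; proofs where landed; nothing here is a claim about the
Yang–Mills mass gap

PDF held: `paper:balaban1988-cmp116-rg-ii-cluster` (journal page = PDF page + 0), pp. 15–17 (quoted in full in `B13Term214`,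
`B13FirstEstimate215`, `B13Replacement223`, `B13Bound226Primitive`, `B13Lemma3TorusPrimitive`); `paper:balaban1987-cmp109-rg-i`
pp. 266–268 (render `b2b-balaban-ref1/pages/1987-cmp109-rg-I-small-field/…-p019/p020/p021-x2.png`).

CITATION HEADER.  [II] p. 15 (2.15) and p. 17 (2.26) as quoted in `B13Bound226Primitive`; [I] p. 268, after (2.13): *"Let us
remark that the expression under the exponential above vanishes at g_k = 0"*.  NOT PRINTED: the second-order (in the coupling)
bound on the CENTRED term; what is recorded here is that print's own chain gives it once the integrand is centred
(`B13Term214Centred.norm_core214_sub_le_215_centred`: joint parity kills the odd first order EXACTLY, (2.15) prices the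
second-order remainder), the rest of pp. 15–17 running VERBATIM on the remainder's Gaussian-shaped majorant
(`B13Replacement223.replaced_le_226`, the located letters of `B13Bound226Located`, the Cauchy layer of `B13CauchyDecayPoly`).

PROVENANCE.  The road is lens Card T21 (`run/shared/lean/pub/pub-ymgap/ym-lens-BalabanUVNodes-transfer/LENS-transfer.md` §18,
seat `ym-lens-BalabanUVNodes-transfer` g12, rider P⁗: *«OFFERED to n10-c … ONE torus-level application
`h226_torus_windowDilated_centred_of_primitives`»*); this file types that application.  Cell `pub-ymgap`, seat
`pub-ymgap-dag-n10-c` (g6), node N10 [B13]; consumer: node N22's (S-vertex-T′)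
(`Summits/…/BalabanUVNodesN22W1RelCentredTermDatum214Generated`, `hdata` l.135–142), producer unowned (N09's side: the centre
`V`, the Taylor∕parity letters of the datum).

WHAT IS HERE (no definition).
* §1 LINEARITY OF THE TERM in its `X`-integral: `DopC_sub` (the corner sum is linear) and `term214_sub_of_sepHolOnPoly` (two
  separately holomorphic `X`-integrals: the difference of the terms is the term of the difference — `term214_eq_DopC_polyτ` ×3).
* §2 THE POINTWISE CENTRED BOUND FROM THE ENTRYWISE LETTERS, located geometry (`norm_core214_sub_le_K_centred_of_primitives`):
  at one `(σ, τ)`, for a complex symmetric precision `A′` with `Re A′ ≻ 0`, a linear source `Γ′X = G′·X`, the reference `C ≻ 0`,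
  `Γ₀`, the letters `K_G, K_Γ, K_{Cσ}, K₀, θ_Γ, θ_C, θ_E` of `A′, G′` and the capstone's numeric conditions at the MASTER Gaussian
  rate `γ₂ + a_c` (`a_c ≥ a₂₀, a₂, (1+s)a₁`); last lines `F214(χ, χᶜ, 𝐕)`, `F214(χ, χᶜ, 𝐕₀)` with `χ, χᶜ, 𝐕₀` EVEN, `𝐕₁` ODD,
  (2.22), (2.20) for `𝐕`, `Σ|τ||𝐕₀| ≤ w₀`, and the Taylor letters `Σ|τ||𝐕 − 𝐕₀| ≤ s(½a₁‖B‖² + w₁)`,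
  `Σ|τ||𝐕 − 𝐕₀ − 𝐕₁| ≤ s²(½a₂‖B‖² + w₂)`: `‖core(F214 𝐕) − core(F214 𝐕₀)‖ ≤ s²·e^{2η|Λ|}·e^{w_c}e^{−½γ₂r²|P|}·e^{αc|Λ|}e^{α(1+2cg)|N|}`
  (`α = 2θ′ + γ₂ + a_c`) — the centred (2.15) with its six integrability side conditions DISCHARGED from the letters
  (`B13Term214Centred.integrable_inner∕outer_of_letters`), then `replaced_le_226`.
* §3 ON THE TWO-SCALE TORUS ALONG THE WINDOW-DILATED FAMILY (`h226_torus_windowDilated_centred_of_primitives`): for every `b`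
  of the ball `|b − 1| < ρ_b`, `‖term(b²A, bG, F214 χ χᶜ 𝐕) − term(b²A, bG, F214 χ χᶜ 𝐕₀)‖ ≤ s²·weight L M c Z a t·e^{a₅|Z|}` from
  the b = 1 letters of `B13Term214WindowDilated.h226_torus_windowDilated_of_primitives` + `K_E` + the inflation inequalities,
  the parity data, the Taylor letters on the per-domain τ-region, and `hvol` with the centred constants' letter `w_c`;
  `Re(b²A(σ)) ≻ 0` derived; separate holomorphy of both `X`-integrals derived (`sepHolOn_core214_sigma_of_primitives`,
  `sepHolOnPoly_core214_tau_of_primitives`); Cauchy layer `norm_term214_le_215_polyτ` on the DIFFERENCE; §1 identifies it.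
HONEST SCOPE.  No estimate new in kind; the only Gaussian inequality is print's (2.15), once, on the centred remainder.  The
centre `𝐕₀` (lens T22: the older terms at the background; zero for σ-differentiated terms by `B13SigmaFreeKernels.term214_sigmaFree`),
the odd part `𝐕₁`, the Taylor letters `(a₁, w₁, a₂, w₂, w₀)` and the evenness of the boxes are the PRODUCER's data about the
datum ([I] (2.9)–(2.13): boxes are norms, the action is even, the cubic vertex and the first derivative of the older terms are
odd, no `s⁻¹` term at the critical background) — HYPOTHESES here; `s` is any real `≥ 0` (for the consumer: the real base point,
`s² ≤ |u|²`).  Nothing of Bałaban's kernels is constructed; N10∕N22∕N09 NOT discharged.  No `sorry`, no definition, no new named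
fact (D-0026).
-/

noncomputable section

namespace Literature.MathematicalPhysics.QuantumFieldTheory.Balaban1983to89.B13Bound226Centred

open Matrix MeasureTheory Finset Complex Metric Set
open scoped Real
open B13GaugeDevices (gaussWeight gaussInt gaussNorm gaussMean)
open B2Eq228Conditioning (gaussNorm_pos gaussWeight_pos)
open B13PerturbativeStep (WeightHyp)
open B13Term214 (cquad cgaussWeight cgaussInt cgaussNorm cgaussMean integrand214 core214 F214 term214 SepHolOn DopC
  cornerC)
open B13Integral223 (innerB posDef_inv_sub_smul integral223_le norm_F214_le)
open B13FirstEstimate215 (norm_integrand214_le_215)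
open B13Replacement223 (replaced_le_226 integrable_hg215_gauss integrable_hX215_gauss gaussMean_nonneg)
open B13Eq216FirstForm (hdef1_of_linear)
open B13Bound226Primitive (hdef3_of_linear h216R3_of_diff continuous_of_linear)
open B13Bound226Located (h216R1_of_factors hR1_of_entrywise hR2_of_entrywise hR3_of_entrywise h17a_of_entrywise
  h17b_of_entrywise entry_bound_mono_rate Kc_nonneg kc_l1_nonneg)
open B13CauchyDecay (closedBall_subset_closedBall_of_mem_uIcc two_mul_invTau_eq)
open B13CauchyDecayPoly (SepHolOnPoly term214_eq_DopC_polyτ norm_term214_le_215_polyτ)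
open B13Core214Holomorphic (measurable_F214)
open B13Core214HolomorphicPrimitive (sepHolOn_core214_sigma_of_primitives)
open B13Bound226LocatedPoly (sepHolOnPoly_core214_tau_of_primitives)
open B13Lemma3TorusPrimitive (weightHyp_tdist1 tdist1_symm kc_tdist1)
open B13Term214WindowDilated (smul_entry_le smul_sub_entry_le inv_sq_smul_entry_le inv_sq_smul_sub_entry_le
  sq_smul_sub_entry_le h220_dilate rad_nonneg_of_mem_ball posDef_re_of_form theta_mul_lt_one)
open B13Term214Centred (cgaussMean_integrand214_eq_zero_of_jointOdd norm_core214_sub_le_215_centred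
  integrable_inner_of_letters integrable_outer_of_letters norm_F214_centred_le_gauss centredLinearPart_odd F214_neg_of_even)
open TreeLengthTorus (TPt TDom tsys)
open TreeLengthTorusTransfer (tclosure)
open B13Lemma3TorusData (TBond)
open B13Lemma3TorusTerms (weight Z0)
open B13Bound143 (invTau)
open B5TorusCover (UT)
open B9Thm37GlueTorus (tdist1)

/-! ## §1. The term (2.14) is linear in its `X`-integral (under separate holomorphy) -/

section Linearity

variable {E : Type*} [NormedAddCommGroup E] [NormedSpace ℂ E]
variable {ι : Type*} [DecidableEq ι]

/-- The iterated corner difference `D_S` of (2.8)∕(2.1) is LINEAR: `D_S(Φ − Φ′) = D_SΦ − D_SΦ′` (a finite signed sum).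
[cite: Balaban1988RG2Cluster, (2.8) p.14, (2.14) p.15] (elementary API for (2.14)) -/
theorem DopC_sub (S : Finset ι) (Φ Φ' : (ι → ℂ) → E) (p : ι → ℂ) :
    DopC S (fun q => Φ q - Φ' q) p = DopC S Φ p - DopC S Φ' p := by
  simp only [DopC, smul_sub, Finset.sum_sub_distrib]

variable [CompleteSpace E]

/-- **The term (2.14) is linear in its `X`-integral**: for two functions `Ψ`, `Ψ′` of the parameters, each separately
holomorphic in `σ` on `Uσ` and of the poly class in `τ` on the per-domain regions `Uτ` (containing the contour discs), the
term of the difference is the difference of the terms — both sides are the double corner difference (`term214_eq_DopC_polyτ`),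
which is linear (`DopC_sub`). [cite: Balaban1988RG2Cluster, (2.14) p.15, (2.8) p.14, (2.1) p.12] -/
theorem term214_sub_of_sepHolOnPoly {κ : Type*} [DecidableEq κ] {Uσ : Set ℂ} {Uτ : κ → Set ℂ}
    (hUσ : IsOpen Uσ) (hUτ : ∀ Y, IsOpen (Uτ Y)) {r : ℝ} (hr : 0 < r)
    (hsubσ : ∀ s ∈ Set.uIcc (0 : ℝ) 1, closedBall (s : ℂ) r ⊆ Uσ)
    (hsubτ : ∀ Y, ∀ s ∈ Set.uIcc (0 : ℝ) 1, closedBall (s : ℂ) r ⊆ Uτ Y) {Ψ Ψ' : (ι → ℂ) → (κ → ℂ) → E}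
    (hΨσ : ∀ τ : κ → ℂ, (∀ j, τ j ∈ Uτ j) → SepHolOn Uσ (fun σ => Ψ σ τ))
    (hΨτ : ∀ σ : ι → ℂ, (∀ j, σ j ∈ Uσ) → SepHolOnPoly Uτ (fun τ => Ψ σ τ))
    (hΨ'σ : ∀ τ : κ → ℂ, (∀ j, τ j ∈ Uτ j) → SepHolOn Uσ (fun σ => Ψ' σ τ))
    (hΨ'τ : ∀ σ : ι → ℂ, (∀ j, σ j ∈ Uσ) → SepHolOnPoly Uτ (fun τ => Ψ' σ τ))
    {lZ : List ι} (hlZ : lZ.Nodup) {lD : List κ} (hlD : lD.Nodup) {σ₀ : ι → ℂ} (hσ₀ : ∀ j, σ₀ j ∈ Uσ)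
    {τ₀ : κ → ℂ} (hτ₀ : ∀ j, τ₀ j ∈ Uτ j) :
    term214 r lZ lD (fun σ τ => Ψ σ τ - Ψ' σ τ) σ₀ τ₀ = term214 r lZ lD Ψ σ₀ τ₀ - term214 r lZ lD Ψ' σ₀ τ₀ := by
  have hDσ : ∀ τ : κ → ℂ, (∀ j, τ j ∈ Uτ j) → SepHolOn Uσ (fun σ => Ψ σ τ - Ψ' σ τ) :=
    fun τ hτ i p hp => (hΨσ τ hτ i p hp).sub (hΨ'σ τ hτ i p hp)
  have hDτ : ∀ σ : ι → ℂ, (∀ j, σ j ∈ Uσ) → SepHolOnPoly Uτ (fun τ => Ψ σ τ - Ψ' σ τ) :=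
    fun σ hσ i p hp => (hΨτ σ hσ i p hp).sub (hΨ'τ σ hσ i p hp)
  rw [term214_eq_DopC_polyτ hUσ hUτ hr hsubσ hsubτ hDσ hDτ hlZ hlD hσ₀ hτ₀,
    term214_eq_DopC_polyτ hUσ hUτ hr hsubσ hsubτ hΨσ hΨτ hlZ hlD hσ₀ hτ₀,
    term214_eq_DopC_polyτ hUσ hUτ hr hsubσ hsubτ hΨ'σ hΨ'τ hlZ hlD hσ₀ hτ₀, ← DopC_sub]
  congr 1
  funext σ
  exact DopC_sub _ _ _ _

end Linearity

/-! ## §2. The pointwise centred bound from the entrywise letters (located geometry) -/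

section Pointwise

variable {S : Type*} [DecidableEq S] {ρ : S → S → ℝ} {Kc : ℝ → ℝ}
variable {Λ : Type} [Fintype Λ] [DecidableEq Λ] {C₀ : Type} [Fintype C₀] [DecidableEq C₀]
variable {D : Type*}

omit [DecidableEq Λ] in
/-- The odd part's (2.20)-type size: `Σ|τ||𝐕₁| ≤ s(½a₁‖B‖² + w₁) + s²(½a₂‖B‖² + w₂) ≤ (s·e^{w₁} + s²·e^{w₂})·e^{½a_c‖B‖²}`
(triangle inequality between the two Taylor letters; `y ≤ e^y`). [cite: Balaban1988RG2Cluster, (2.20) p.16] (elementary API for (2.20)) -/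
theorem sum_norm_V₁_le (Dfam : Finset D) (τ : D → ℂ) {V V₀ V₁ : D → (Λ → ℝ) → ℂ} (B : Λ → ℝ)
    {s a₁ w₁ a₂ w₂ ac : ℝ} (hs : 0 ≤ s) (ha₁ : 0 ≤ a₁) (hac₂ : a₂ ≤ ac) (hac₁ : (1 + s) * a₁ ≤ ac)
    (h1 : ∑ Y ∈ Dfam, ‖τ Y‖ * ‖V Y B - V₀ Y B‖ ≤ s * (a₁ / 2 * (B ⬝ᵥ B) + w₁))
    (h2 : ∑ Y ∈ Dfam, ‖τ Y‖ * ‖V Y B - V₀ Y B - V₁ Y B‖ ≤ s ^ 2 * (a₂ / 2 * (B ⬝ᵥ B) + w₂)) :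
    ∑ Y ∈ Dfam, ‖τ Y‖ * ‖V₁ Y B‖
      ≤ (s * Real.exp w₁ + s ^ 2 * Real.exp w₂) * Real.exp (ac / 2 * (B ⬝ᵥ B)) := by
  have hBB : 0 ≤ B ⬝ᵥ B := Finset.sum_nonneg fun i _ => mul_self_nonneg (B i)
  have htri : ∑ Y ∈ Dfam, ‖τ Y‖ * ‖V₁ Y B‖
      ≤ ∑ Y ∈ Dfam, ‖τ Y‖ * ‖V Y B - V₀ Y B‖ + ∑ Y ∈ Dfam, ‖τ Y‖ * ‖V Y B - V₀ Y B - V₁ Y B‖ := by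
    rw [← Finset.sum_add_distrib]
    refine Finset.sum_le_sum fun Y _ => ?_
    rw [← mul_add]
    refine mul_le_mul_of_nonneg_left ?_ (norm_nonneg _)
    have e : V₁ Y B = (V Y B - V₀ Y B) - (V Y B - V₀ Y B - V₁ Y B) := by ring
    calc ‖V₁ Y B‖ = ‖(V Y B - V₀ Y B) - (V Y B - V₀ Y B - V₁ Y B)‖ := by rw [← e]
      _ ≤ _ := norm_sub_le _ _
  have ha1ac : a₁ ≤ ac := by linarith only [hac₁, mul_nonneg hs ha₁]
  have hy : ∀ {a' w' : ℝ}, a' ≤ ac → a' / 2 * (B ⬝ᵥ B) + w' ≤ Real.exp w' * Real.exp (ac / 2 * (B ⬝ᵥ B)) :=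
    fun {a' w'} ha' => by
      rw [← Real.exp_add]
      have h1 : a' / 2 * (B ⬝ᵥ B) ≤ ac / 2 * (B ⬝ᵥ B) := mul_le_mul_of_nonneg_right (by linarith only [ha']) hBB
      have h2 := Real.add_one_le_exp (w' + ac / 2 * (B ⬝ᵥ B))
      linarith only [h1, h2]
  have hy₁ := hy (w' := w₁) ha1ac
  have hy₂ := hy (w' := w₂) hac₂
  calc ∑ Y ∈ Dfam, ‖τ Y‖ * ‖V₁ Y B‖
      ≤ s * (a₁ / 2 * (B ⬝ᵥ B) + w₁) + s ^ 2 * (a₂ / 2 * (B ⬝ᵥ B) + w₂) := htri.trans (add_le_add h1 h2)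
    _ ≤ s * (Real.exp w₁ * Real.exp (ac / 2 * (B ⬝ᵥ B))) + s ^ 2 * (Real.exp w₂ * Real.exp (ac / 2 * (B ⬝ᵥ B))) :=
        add_le_add (mul_le_mul_of_nonneg_left hy₁ hs) (mul_le_mul_of_nonneg_left hy₂ (sq_nonneg _))
    _ = (s * Real.exp w₁ + s ^ 2 * Real.exp w₂) * Real.exp (ac / 2 * (B ⬝ᵥ B)) := by ring

/-- **THE POINTWISE CENTRED BOUND FROM THE ENTRYWISE LETTERS** (located geometry; one `(σ, τ)`).  Objects at this `σ`: a
complex symmetric precision `A′` with `Re A′ ≻ 0`, a LINEAR source `Γ′X = G′·X`, the reference `C ≻ 0`, `Γ₀`; the located letters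
of `A′, G′` (`K_G, K_Γ, K_{Cσ}, K₀` at rate `κ`, `θ_Γ, θ_C, θ_E`, rates `κ > κ′ > κ″ > 0`, majorant `θ`, `K′θ′ < 1`); last lines
`F214(χ, χᶜ, 𝐕)` and `F214(χ, χᶜ, 𝐕₀)` at this `τ` with `χ, χᶜ ≥ 0` measurable and EVEN, `𝐕₀(Y,·)` EVEN, `𝐕₁(Y,·)` ODD, all
measurable; (2.22); (2.20) for `𝐕` (`a₂₀, w`) and `Σ|τ||𝐕₀| ≤ w₀`; the Taylor letters `Σ|τ||𝐕 − 𝐕₀| ≤ s(½a₁‖B‖² + w₁)`,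
`Σ|τ||𝐕 − 𝐕₀ − 𝐕₁| ≤ s²(½a₂‖B‖² + w₂)` (`s ≥ 0`); a master rate `a_c ≥ a₂₀, a₂, (1+s)a₁` and the capstone's numeric conditions
at `α = 2θ′ + γ₂ + a_c`; the centred constants' letter `e^{w₀}(e^{w₂} + 2e^{(1+s)w₁}) ≤ e^{w_c}`.  Conclusion:
`‖∫dμ₀(X)(lines 2–3)(F214 𝐕) − ∫dμ₀(X)(lines 2–3)(F214 𝐕₀)‖ ≤ s²·e^{2η|Λ|}·e^{w_c}e^{−½γ₂r²|P|}·e^{αc|Λ|}·e^{α(1+2cg)|N|}` — the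
centred (2.15) (`B13Term214Centred.norm_core214_sub_le_215_centred`, its integrability side conditions discharged by
`integrable_inner∕outer_of_letters`, `integrable_hg215∕hX215_gauss`) followed by `B13Replacement223.replaced_le_226` on the
Gaussian-shaped centred majorant (`norm_F214_centred_le_gauss`). [cite: Balaban1988RG2Cluster, (2.14)–(2.15) p.15, (2.16)–(2.22) p.16, (2.23)–(2.26) p.17; Balaban1987RG1, (2.13) p.268] -/
theorem norm_core214_sub_le_K_centred_of_primitives (hρ : WeightHyp 0 ρ) (hρs : ∀ x y : S, ρ x y = ρ y x)
    (hKc : ∀ b : ℝ, 0 < b → ∀ (T : Finset S) (x : S), ∑ y ∈ T, Real.exp (-(b * ρ x y)) ≤ Kc b)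
    (hKc0 : ∀ b : ℝ, 0 < b → 0 ≤ Kc b)
    {A : Matrix Λ Λ ℂ} (hAs : A.IsSymm) (hA : (A.map Complex.re).PosDef)
    {Γ : (Λ ⊕ C₀ → ℝ) → (Λ → ℂ)} {G : Matrix Λ (Λ ⊕ C₀) ℂ} (hlin : ∀ X : Λ ⊕ C₀ → ℝ, Γ X = G *ᵥ fun j => (X j : ℂ))
    {C : Matrix Λ Λ ℝ} (hC : C.PosDef) (Γ₀ : Matrix Λ (Λ ⊕ C₀) ℝ)
    -- the last lines at this τ: boxes, potentials, centre, odd part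
    (cardP : ℕ) {χY₀ χcP : (Λ → ℝ) → ℝ} (hχm : Measurable χY₀) (hχcm : Measurable χcP)
    (hχ0 : ∀ B, 0 ≤ χY₀ B) (hχc0 : ∀ B, 0 ≤ χcP B) (hχe : ∀ B, χY₀ (-B) = χY₀ B) (hχce : ∀ B, χcP (-B) = χcP B)
    (Dfam : Finset D) {V V₀ V₁ : D → (Λ → ℝ) → ℂ} (hVm : ∀ Y, Measurable (V Y)) (hV₀m : ∀ Y, Measurable (V₀ Y))
    (hV₁m : ∀ Y, Measurable (V₁ Y)) (hV₀e : ∀ Y B, V₀ Y (-B) = V₀ Y B) (hV₁o : ∀ Y B, V₁ Y (-B) = -V₁ Y B) (τ : D → ℂ)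
    {γ₂ rP a₂₀ w w₀ s a₁ w₁ a₂ w₂ ac wc : ℝ} (qP : (Λ → ℝ) → ℝ)
    (h222 : ∀ B, χY₀ B * χcP B ≤ Real.exp (-(γ₂ / 2 * rP ^ 2 * cardP) + γ₂ / 2 * qP B)) (hγ₂ : 0 ≤ γ₂)
    (hqP : ∀ B, qP B ≤ B ⬝ᵥ B)
    (h220 : ∀ B, ∑ Y ∈ Dfam, ‖τ Y‖ * ‖V Y B‖ ≤ a₂₀ / 2 * (B ⬝ᵥ B) + w) (ha₂₀ : 0 ≤ a₂₀)
    (hw₀ : ∀ B, ∑ Y ∈ Dfam, ‖τ Y‖ * ‖V₀ Y B‖ ≤ w₀)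
    (hs : 0 ≤ s) (ha₁ : 0 ≤ a₁) (hw₁ : 0 ≤ w₁) (ha₂ : 0 ≤ a₂) (hw₂ : 0 ≤ w₂)
    (h1 : ∀ B, ∑ Y ∈ Dfam, ‖τ Y‖ * ‖V Y B - V₀ Y B‖ ≤ s * (a₁ / 2 * (B ⬝ᵥ B) + w₁))
    (h2 : ∀ B, ∑ Y ∈ Dfam, ‖τ Y‖ * ‖V Y B - V₀ Y B - V₁ Y B‖ ≤ s ^ 2 * (a₂ / 2 * (B ⬝ᵥ B) + w₂))
    (hac₀ : a₂₀ ≤ ac) (hac₂ : a₂ ≤ ac) (hac₁ : (1 + s) * a₁ ≤ ac)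
    (hwc : Real.exp w₀ * (Real.exp w₂ + 2 * Real.exp ((1 + s) * w₁)) ≤ Real.exp wc)
    -- located bonds and letters
    (locΛ : Λ → S) (locN : Λ ⊕ C₀ → S) {m : ℕ}
    (hfibΛ : ∀ x : S, (Finset.univ.filter fun i => locΛ i = x).card ≤ m)
    (hfibN : ∀ x : S, (Finset.univ.filter fun j => locN j = x).card ≤ m)
    {kap kap' kap'' θ θE θΓ θC KG KΓ KCs K₀ : ℝ} (hkap'' : 0 < kap'') (hk1 : kap'' < kap') (hk2 : kap' < kap)
    (hθE : 0 ≤ θE) (hθΓ : 0 ≤ θΓ) (hθC : 0 ≤ θC) (hKG : 0 ≤ KG) (hKΓ : 0 ≤ KΓ) (hKCs : 0 ≤ KCs) (hK₀ : 0 ≤ K₀)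
    (hθEle : θE ≤ θ) (hθΓle : θΓ ≤ θ)
    (hθR1le : (m * Kc (kap - kap')) * (m * Kc (kap' - kap''))
      * (θΓ * KCs * KG + KΓ * θC * KG + KΓ * K₀ * θΓ) ≤ θ)
    (hG : ∀ b j, ‖G b j‖ ≤ KG * Real.exp (-(kap * ρ (locΛ b) (locN j))))
    (hΓ₀ : ∀ b j, ‖Γ₀ b j‖ ≤ KΓ * Real.exp (-(kap * ρ (locΛ b) (locN j))))
    (hCs : ∀ b b', ‖A⁻¹ b b'‖ ≤ KCs * Real.exp (-(kap * ρ (locΛ b) (locΛ b'))))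
    (hC216 : ∀ b b', ‖C b b'‖ ≤ K₀ * Real.exp (-(kap * ρ (locΛ b) (locΛ b'))))
    (hdΓ : ∀ b j, ‖(G - Γ₀.map (algebraMap ℝ ℂ)) b j‖ ≤ θΓ * Real.exp (-(kap * ρ (locΛ b) (locN j))))
    (hdC : ∀ b b', ‖(A⁻¹ - C.map (algebraMap ℝ ℂ)) b b'‖ ≤ θC * Real.exp (-(kap * ρ (locΛ b) (locΛ b'))))
    (hdE : ∀ b b', ‖(A - C⁻¹.map (algebraMap ℝ ℂ)) b b'‖ ≤ θE * Real.exp (-(kap * ρ (locΛ b) (locΛ b'))))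
    (hsmallKθ : K₀ * (m * Kc kap) * (θ * (m * Kc kap'')) < 1)
    {c g : ℝ} (hc0 : 0 ≤ c) (hc : ∀ k, hC.1.eigenvalues k ≤ c)
    (hαc : (2 * (θ * (m * Kc kap'')) + (γ₂ + ac)) * c ≤ 1 / 2) (hg : 0 ≤ g)
    (hΓq : ∀ X : Λ ⊕ C₀ → ℝ, (Γ₀ *ᵥ X) ⬝ᵥ (C *ᵥ (Γ₀ *ᵥ X)) ≤ g * (X ⬝ᵥ X))
    (hsmall : (2 * (θ * (m * Kc kap'')) + (γ₂ + ac)) * (1 + 2 * c * g) ≤ 1 / 2) :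
    ‖cgaussMean (1 : Matrix (Λ ⊕ C₀) (Λ ⊕ C₀) ℂ) (fun X => integrand214 A Γ (F214 cardP χY₀ χcP Dfam V τ) X)
        - cgaussMean (1 : Matrix (Λ ⊕ C₀) (Λ ⊕ C₀) ℂ) (fun X => integrand214 A Γ (F214 cardP χY₀ χcP Dfam V₀ τ) X)‖
      ≤ s ^ 2 * (Real.exp (2 * (K₀ * (m * Kc kap) * (θ * (m * Kc kap''))
              * (1 + (1 - K₀ * (m * Kc kap) * (θ * (m * Kc kap'')))⁻¹) / 2) * Fintype.card Λ)
          * (Real.exp wc * Real.exp (-(γ₂ / 2 * rP ^ 2 * cardP)))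
          * (Real.exp ((2 * (θ * (m * Kc kap'')) + (γ₂ + ac)) * c * Fintype.card Λ)
            * Real.exp ((2 * (θ * (m * Kc kap'')) + (γ₂ + ac)) * (1 + 2 * c * g) * Fintype.card (Λ ⊕ C₀)))) := by
  -- shorthand for the located constants
  set θ' : ℝ := θ * (m * Kc kap'') with hθ'
  set η : ℝ := K₀ * (m * Kc kap) * (θ * (m * Kc kap'')) * (1 + (1 - K₀ * (m * Kc kap) * (θ * (m * Kc kap'')))⁻¹) / 2
    with hη
  have hθ : 0 ≤ θ := hθE.trans hθEle
  have hkap : 0 < kap := hkap''.trans (hk1.trans hk2)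
  have hkk : kap'' ≤ kap := (hk1.trans hk2).le
  have hθ'0 : 0 ≤ θ' := mul_nonneg hθ (mul_nonneg (Nat.cast_nonneg m) (hKc0 _ hkap''))
  have hac0 : 0 ≤ ac := ha₂₀.trans hac₀
  have hexp : ∀ x : ℝ, 0 ≤ Real.exp x := fun x => (Real.exp_pos x).le
  have hBB : ∀ B : Λ → ℝ, 0 ≤ B ⬝ᵥ B := fun B => Finset.sum_nonneg fun i _ => mul_self_nonneg (B i)
  -- entrywise (2.16) for R₁, E, R₃ at rate κ″ with the common majorant θ
  have h216R1 : ∀ b b', ‖(Γ₀ᵀ * C * Γ₀ - (Gᵀ * A⁻¹ * G).map Complex.re) b b'‖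
      ≤ θ * Real.exp (-(kap'' * ρ (locN b) (locN b'))) := fun b b' =>
    (h216R1_of_factors hρ hρs hKc hKc0 hθΓ hθC hKG hKΓ hKCs hK₀ hkap''.le hk1 hk2 locΛ locN hfibΛ
      hdΓ hdC hG hΓ₀ hCs hC216 b b').trans (mul_le_mul_of_nonneg_right hθR1le (hexp _))
  have h216E : ∀ b b', ‖(A - C⁻¹.map (algebraMap ℝ ℂ)) b b'‖ ≤ θ * Real.exp (-(kap'' * ρ (locΛ b) (locΛ b'))) :=
    fun b b' => (entry_bound_mono_rate hρ hθE hkk locΛ locΛ hdE b b').trans (mul_le_mul_of_nonneg_right hθEle (hexp _))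
  have h216R3 : ∀ i j, ‖(G.map Complex.re - Γ₀) i j‖ ≤ θ * Real.exp (-(kap'' * ρ (locΛ i) (locN j))) := by
    have hmono : ∀ i j, ‖(G - Γ₀.map (algebraMap ℝ ℂ)) i j‖ ≤ θ * Real.exp (-(kap'' * ρ (locΛ i) (locN j))) :=
      fun i j => (entry_bound_mono_rate hρ hθΓ hkk locΛ locN hdΓ i j).trans (mul_le_mul_of_nonneg_right hθΓle (hexp _))
    exact fun i j => h216R3_of_diff hmono i j
  -- the replacement letters in their printed (form) shapes
  have hR1 : ∀ X : Λ ⊕ C₀ → ℝ, -(1 / 2) * ((Γ X) ⬝ᵥ (A⁻¹ *ᵥ Γ X)).re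
      ≤ -(1 / 2 * ((Γ₀ *ᵥ X) ⬝ᵥ (C *ᵥ (Γ₀ *ᵥ X)))) + θ' / 2 * (X ⬝ᵥ X) := fun X =>
    hR1_of_entrywise hρ hρs hKc Γ Γ₀ _ hθ hkap'' locN hfibN (hdef1_of_linear A G Γ hlin C Γ₀) h216R1 X
  have h17a := h17a_of_entrywise hρ hρs hKc hC hA hθ hkap'' hK₀ hkap locΛ hfibΛ hC216 h216E hsmallKθ
  have h17b := h17b_of_entrywise hρ hρs hKc hC hA hθ hkap'' hK₀ hkap locΛ hfibΛ hC216 h216E hsmallKθ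
  have hR2 : ∀ B : Λ → ℝ, B ⬝ᵥ ((C⁻¹ - A.map Complex.re) *ᵥ B) ≤ θ' * (B ⬝ᵥ B) := fun B =>
    hR2_of_entrywise hρ hρs hKc hθ hkap'' locΛ hfibΛ h216E B
  have hR3 : ∀ (X : Λ ⊕ C₀ → ℝ) (B : Λ → ℝ), -(B ⬝ᵥ fun i => (Γ X i).re)
      ≤ -(B ⬝ᵥ (Γ₀ *ᵥ X)) + θ' / 2 * (X ⬝ᵥ X + B ⬝ᵥ B) := fun X B =>
    hR3_of_entrywise hρs hKc Γ Γ₀ _ hθ hkap'' locΛ locN hfibΛ hfibN (hdef3_of_linear G Γ hlin Γ₀) h216R3 X B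
  have hΓc : Continuous Γ := continuous_of_linear G Γ hlin
  have hΓodd : ∀ X, Γ (-X) = -Γ X := fun X => by
    have h1 : (fun j => (((-X) j : ℝ) : ℂ)) = -fun j => ((X j : ℝ) : ℂ) := by
      funext j; simp only [Pi.neg_apply, Complex.ofReal_neg]
    rw [hlin, hlin, h1, Matrix.mulVec_neg]
  -- numerics at the master rate α = 2θ′ + γ₂ + a_c
  have hα0 : 0 ≤ 2 * θ' + (γ₂ + ac) := by positivity
  have hαlt : (2 * θ' + (γ₂ + ac)) * (1 + 2 * c * g) < 1 := lt_of_le_of_lt hsmall (by norm_num)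
  have hsm : (2 * θ' + (γ₂ + ac)) * c < 1 := lt_of_le_of_lt hαc (by norm_num)
  have hρac : (θ' + (γ₂ + ac)) * c < 1 := by linarith only [hsm, mul_nonneg hθ'0 hc0]
  have hαPD : (C⁻¹ - (2 * θ' + (γ₂ + ac)) • (1 : Matrix Λ Λ ℝ)).PosDef := posDef_inv_sub_smul hC hc hsm
  -- the three last lines and their Gaussian bounds at the master rate
  set F : (Λ → ℝ) → ℂ := F214 cardP χY₀ χcP Dfam V τ with hF
  set F₀ : (Λ → ℝ) → ℂ := F214 cardP χY₀ χcP Dfam V₀ τ with hF₀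
  set ℓ : (Λ → ℝ) → ℂ := fun B => F214 cardP χY₀ χcP Dfam V₀ τ B * ∑ Y ∈ Dfam, τ Y * V₁ Y B with hℓ
  set KP : ℝ := Real.exp (-(γ₂ / 2 * rP ^ 2 * cardP)) with hKP
  have hKP0 : 0 ≤ KP := hexp _
  -- monotonicity of the Gaussian factor in the rate
  have hmono : ∀ (B : Λ → ℝ) {a : ℝ}, a ≤ ac →
      Real.exp ((γ₂ + a) / 2 * (B ⬝ᵥ B)) ≤ Real.exp ((γ₂ + ac) / 2 * (B ⬝ᵥ B)) := fun B a ha =>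
    Real.exp_le_exp.2 (mul_le_mul_of_nonneg_right (by linarith only [ha]) (hBB B))
  have hFb : ∀ B, ‖F B‖ ≤ (KP * Real.exp w) * Real.exp ((γ₂ + ac) / 2 * (B ⬝ᵥ B)) := fun B => by
    have h := norm_F214_le cardP χY₀ χcP Dfam V τ qP B (hχ0 B) (hχc0 B) (h222 B) hγ₂ (hqP B) (h220 B)
    rw [hKP, ← Real.exp_add]
    exact h.trans (mul_le_mul_of_nonneg_left (hmono B hac₀) (hexp _))
  have h220₀ : ∀ B, ∑ Y ∈ Dfam, ‖τ Y‖ * ‖V₀ Y B‖ ≤ 0 / 2 * (B ⬝ᵥ B) + w₀ := fun B => by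
    rw [zero_div, zero_mul, zero_add]; exact hw₀ B
  have hF₀b : ∀ B, ‖F₀ B‖ ≤ (KP * Real.exp w₀) * Real.exp ((γ₂ + ac) / 2 * (B ⬝ᵥ B)) := fun B => by
    have h := norm_F214_le cardP χY₀ χcP Dfam V₀ τ qP B (hχ0 B) (hχc0 B) (h222 B) hγ₂ (hqP B) (h220₀ B)
    rw [hKP, ← Real.exp_add]
    exact h.trans (mul_le_mul_of_nonneg_left (hmono B hac0) (hexp _))
  have hℓb : ∀ B, ‖ℓ B‖ ≤ (KP * Real.exp w₀ * (s * Real.exp w₁ + s ^ 2 * Real.exp w₂))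
      * Real.exp ((γ₂ + ac) / 2 * (B ⬝ᵥ B)) := fun B => by
    have h0 := norm_F214_le cardP χY₀ χcP Dfam V₀ τ qP B (hχ0 B) (hχc0 B) (h222 B) hγ₂ (hqP B) (h220₀ B)
    have h1' := sum_norm_V₁_le Dfam τ B hs ha₁ hac₂ hac₁ (h1 B) (h2 B)
    have hsum : ‖∑ Y ∈ Dfam, τ Y * V₁ Y B‖ ≤ ∑ Y ∈ Dfam, ‖τ Y‖ * ‖V₁ Y B‖ :=
      (norm_sum_le _ _).trans (Finset.sum_le_sum fun Y _ => (norm_mul _ _).le)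
    show ‖F214 cardP χY₀ χcP Dfam V₀ τ B * ∑ Y ∈ Dfam, τ Y * V₁ Y B‖ ≤ _
    rw [norm_mul]
    calc ‖F214 cardP χY₀ χcP Dfam V₀ τ B‖ * ‖∑ Y ∈ Dfam, τ Y * V₁ Y B‖
        ≤ (Real.exp (-(γ₂ / 2 * rP ^ 2 * cardP) + w₀) * Real.exp ((γ₂ + 0) / 2 * (B ⬝ᵥ B)))
            * ((s * Real.exp w₁ + s ^ 2 * Real.exp w₂) * Real.exp (ac / 2 * (B ⬝ᵥ B))) :=
          mul_le_mul h0 (hsum.trans h1') (norm_nonneg _) (by positivity)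
      _ = (KP * Real.exp w₀ * (s * Real.exp w₁ + s ^ 2 * Real.exp w₂))
            * Real.exp ((γ₂ + ac) / 2 * (B ⬝ᵥ B)) := by
          rw [hKP, Real.exp_add]
          have e : Real.exp ((γ₂ + ac) / 2 * (B ⬝ᵥ B))
              = Real.exp ((γ₂ + 0) / 2 * (B ⬝ᵥ B)) * Real.exp (ac / 2 * (B ⬝ᵥ B)) := by
            rw [← Real.exp_add]; congr 1; ring
          rw [e]; ring
  -- measurability of the three last lines
  have hFm : StronglyMeasurable F := (measurable_F214 cardP hχm hχcm Dfam hVm τ).stronglyMeasurable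
  have hF₀m : StronglyMeasurable F₀ := (measurable_F214 cardP hχm hχcm Dfam hV₀m τ).stronglyMeasurable
  have hℓm : StronglyMeasurable ℓ :=
    ((measurable_F214 cardP hχm hχcm Dfam hV₀m τ).mul
      (Finset.measurable_sum _ fun Y _ => measurable_const.mul (hV₁m Y))).stronglyMeasurable
  -- the centred remainder's Gaussian-shaped majorant
  set Kc' : ℝ := Real.exp w₀ * (Real.exp w₂ + 2 * Real.exp ((1 + s) * w₁)) with hKc'
  have hKc'0 : 0 ≤ Kc' := by positivity
  set ψ : (Λ → ℝ) → ℝ := fun B => (s ^ 2 * Kc' * KP) * Real.exp ((γ₂ + ac) / 2 * (B ⬝ᵥ B)) with hψ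
  have hψK0 : 0 ≤ s ^ 2 * Kc' * KP := by positivity
  have hrem : ∀ B, ‖F B - F₀ B - ℓ B‖ ≤ ψ B := fun B => by
    have h := norm_F214_centred_le_gauss cardP χY₀ χcP Dfam V V₀ V₁ τ B (hχ0 B) (hχc0 B) hs ha₁ hw₁ ha₂ hw₂ hac₂
      hac₁ (hw₀ B) (h1 B) (h2 B)
    have hχ : χY₀ B * χcP B ≤ KP * Real.exp (γ₂ / 2 * (B ⬝ᵥ B)) := by
      rw [hKP, ← Real.exp_add]
      have hq : γ₂ / 2 * qP B ≤ γ₂ / 2 * (B ⬝ᵥ B) := mul_le_mul_of_nonneg_left (hqP B) (by positivity)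
      exact (h222 B).trans (Real.exp_le_exp.2 (by linarith only [hq]))
    show ‖F B - F₀ B - ℓ B‖ ≤ (s ^ 2 * Kc' * KP) * Real.exp ((γ₂ + ac) / 2 * (B ⬝ᵥ B))
    calc ‖F B - F₀ B - ℓ B‖
        ≤ s ^ 2 * (χY₀ B * χcP B * (Kc' * Real.exp (ac / 2 * (B ⬝ᵥ B)))) := h
      _ ≤ s ^ 2 * ((KP * Real.exp (γ₂ / 2 * (B ⬝ᵥ B))) * (Kc' * Real.exp (ac / 2 * (B ⬝ᵥ B)))) :=
          mul_le_mul_of_nonneg_left (mul_le_mul_of_nonneg_right hχ (by positivity)) (sq_nonneg _)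
      _ = (s ^ 2 * Kc' * KP) * Real.exp ((γ₂ + ac) / 2 * (B ⬝ᵥ B)) := by
          have e : Real.exp ((γ₂ + ac) / 2 * (B ⬝ᵥ B))
              = Real.exp (γ₂ / 2 * (B ⬝ᵥ B)) * Real.exp (ac / 2 * (B ⬝ᵥ B)) := by
            rw [← Real.exp_add]; congr 1; ring
          rw [e]; ring
  -- integrability of the six actual integrands and of the two majorants, from the letters
  have hγac0 : 0 ≤ γ₂ + ac := add_nonneg hγ₂ hac0
  have hIF : ∀ X, Integrable fun B =>
      cgaussWeight A B * (Complex.exp (-((fun i => (B i : ℂ)) ⬝ᵥ Γ X)) * F B) := fun X =>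
    integrable_inner_of_letters hC hαPD hR2 hR3 hFb hFm X
  have hIF₀ : ∀ X, Integrable fun B =>
      cgaussWeight A B * (Complex.exp (-((fun i => (B i : ℂ)) ⬝ᵥ Γ X)) * F₀ B) := fun X =>
    integrable_inner_of_letters hC hαPD hR2 hR3 hF₀b hF₀m X
  have hIℓ : ∀ X, Integrable fun B =>
      cgaussWeight A B * (Complex.exp (-((fun i => (B i : ℂ)) ⬝ᵥ Γ X)) * ℓ B) := fun X =>
    integrable_inner_of_letters hC hαPD hR2 hR3 hℓb hℓm X
  have hOF : Integrable fun X => cgaussWeight (1 : Matrix (Λ ⊕ C₀) (Λ ⊕ C₀) ℂ) X * integrand214 A Γ F X :=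
    integrable_outer_of_letters hAs hA hΓc hFm hC Γ₀ hθ'0 hγac0 (by positivity) hR1 h17a h17b hR2 hR3 hFb hc0 hc hαc
      hΓq hαlt
  have hOF₀ : Integrable fun X => cgaussWeight (1 : Matrix (Λ ⊕ C₀) (Λ ⊕ C₀) ℂ) X * integrand214 A Γ F₀ X :=
    integrable_outer_of_letters hAs hA hΓc hF₀m hC Γ₀ hθ'0 hγac0 (by positivity) hR1 h17a h17b hR2 hR3 hF₀b hc0 hc hαc
      hΓq hαlt
  have hOℓ : Integrable fun X => cgaussWeight (1 : Matrix (Λ ⊕ C₀) (Λ ⊕ C₀) ℂ) X * integrand214 A Γ ℓ X :=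
    integrable_outer_of_letters hAs hA hΓc hℓm hC Γ₀ hθ'0 hγac0 (by positivity) hR1 h17a h17b hR2 hR3 hℓb hc0 hc hαc
      hΓq hαlt
  have hgI : ∀ X : Λ ⊕ C₀ → ℝ, Integrable (fun B : Λ → ℝ =>
      gaussWeight (A.map Complex.re) B * (Real.exp (-(B ⬝ᵥ fun i => (Γ X i).re)) * ψ B)) := fun X =>
    integrable_hg215_gauss hC (s ^ 2 * Kc' * KP) hR2 hc hρac (Γ X)
  have hXI := integrable_hX215_gauss hA hC hΓc Γ₀ hθ'0 hγac0 hψK0 hR1 h17a h17b hR2 hR3 hc0 hc hαc hΓq hαlt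
  -- the centred (2.15): the odd part `ℓ` integrates to zero exactly
  have hℓodd : ∀ B, ℓ (-B) = -ℓ B := fun B => centredLinearPart_odd cardP Dfam τ hχe hχce hV₀e hV₁o B
  have h215 := norm_core214_sub_le_215_centred hAs hA hΓodd F F₀ ℓ hℓodd ψ hrem hIF hIF₀ hIℓ hOF hOF₀ hOℓ hgI hXI
  -- the replacement (2.16)–(2.26) on the remainder's majorant
  have h226 := replaced_le_226 hA hC Γ Γ₀ hθ'0 hγac0 hψK0 hR1 h17a h17b hR2 hR3 ψ (fun B => by positivity)
    (fun B => le_rfl) hc0 hc hαc hg hΓq hsmall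
  have hR0 : 0 ≤ Real.exp ((2 * θ' + (γ₂ + ac)) * c * Fintype.card Λ)
      * Real.exp ((2 * θ' + (γ₂ + ac)) * (1 + 2 * c * g) * Fintype.card (Λ ⊕ C₀)) := by positivity
  calc ‖cgaussMean (1 : Matrix (Λ ⊕ C₀) (Λ ⊕ C₀) ℂ) (fun X => integrand214 A Γ F X)
          - cgaussMean (1 : Matrix (Λ ⊕ C₀) (Λ ⊕ C₀) ℂ) (fun X => integrand214 A Γ F₀ X)‖
      ≤ Real.exp (2 * η * Fintype.card Λ) * (s ^ 2 * Kc' * KP)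
          * (Real.exp ((2 * θ' + (γ₂ + ac)) * c * Fintype.card Λ)
            * Real.exp ((2 * θ' + (γ₂ + ac)) * (1 + 2 * c * g) * Fintype.card (Λ ⊕ C₀))) := h215.trans h226
    _ ≤ Real.exp (2 * η * Fintype.card Λ) * (s ^ 2 * Real.exp wc * KP)
          * (Real.exp ((2 * θ' + (γ₂ + ac)) * c * Fintype.card Λ)
            * Real.exp ((2 * θ' + (γ₂ + ac)) * (1 + 2 * c * g) * Fintype.card (Λ ⊕ C₀))) := by
        refine mul_le_mul_of_nonneg_right (mul_le_mul_of_nonneg_left ?_ (hexp _)) hR0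
        exact mul_le_mul_of_nonneg_right (mul_le_mul_of_nonneg_left hwc (sq_nonneg _)) hKP0
    _ = s ^ 2 * (Real.exp (2 * η * Fintype.card Λ) * (Real.exp wc * KP)
          * (Real.exp ((2 * θ' + (γ₂ + ac)) * c * Fintype.card Λ)
            * Real.exp ((2 * θ' + (γ₂ + ac)) * (1 + 2 * c * g) * Fintype.card (Λ ⊕ C₀)))) := by ring

end Pointwise

/-! ## §3. On the two-scale torus, along the window-dilated family: the centred letter from the primitive letters at `b = 1` -/

section Torus

variable {d L N' : ℕ} [NeZero L] [NeZero N'] {M : ℕ}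
variable {ν : ℕ} {Nf : Fin ν → ℕ} [∀ i, NeZero (Nf i)]
variable {Λ : Type} [Fintype Λ] [DecidableEq Λ] {C₀ : Type} [Fintype C₀] [DecidableEq C₀]

open Classical in
/-- **THE CENTRED LETTER ALONG THE WINDOW-DILATED FAMILY, for one term of the torus model, from the PRIMITIVE letters at
`b = 1`** (node N22's (S-vertex-T′) per term, lens T21).  Data and letters AT THE REAL COUPLING as in
`B13Term214WindowDilated.h226_torus_windowDilated_of_primitives` (kernels `A(σ)`, `Γ(σ)X = G(σ)·X`, boxes `χ, χᶜ` with (2.22),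
the reference `C ≻ 0`, `Γ₀`, the (L17a)∕(L16a) letters on the open σ-polydisc, `K_E`, the radius `ρ_b < 1` and the primed
letters), and for the last line: the member's potentials `𝐕` (measurable, (2.20) with `(a₂₀, w)` on the per-domain τ-region),
the CENTRE's potentials `𝐕₀` (measurable, EVEN in the field, `Σ|τ||𝐕₀| ≤ w₀`), the ODD part `𝐕₁` (measurable, odd), EVEN boxes,
and the Taylor letters `Σ|τ||𝐕 − 𝐕₀| ≤ s(½a₁‖B‖² + w₁)`, `Σ|τ||𝐕 − 𝐕₀ − 𝐕₁| ≤ s²(½a₂‖B‖² + w₂)` on the τ-region (`s ≥ 0`: for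
the consumer the real base point); a master rate `a_c ≥ a₂₀, a₂, (1+s)a₁`, the centred constants' letter `w_c`, and the
capstone's numeric conditions ∕ `hvol` at `α = 2θ′ + γ₂ + a_c` with `w_c` in place of `w`.  Conclusion: for every `b` of the
ball, `‖term(b²A, bG, F214 χ χᶜ 𝐕) − term(b²A, bG, F214 χ χᶜ 𝐕₀)‖ ≤ s²·weight L M c Z a t·exp(a₅|Z|)` — §2 pointwise on the
polydiscs at the transported letters (`Re(b²A(σ)) ≻ 0` derived), both `X`-integrals separately holomorphic from the primitives,
the Cauchy layer `norm_term214_le_215_polyτ` on their difference, §1, and the p. 17 constant matching.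
[cite: Balaban1988RG2Cluster, (2.14)–(2.15) p.15, (2.16)–(2.22) p.16, (2.23)–(2.26) p.17; Balaban1987RG1, (2.10)-(2.13) pp.267-268] -/
theorem h226_torus_windowDilated_centred_of_primitives (c : B13.Consts) (hκ₁ : 1 ≤ c.κ₁) (hα₆ : c.α₆ ≠ 0)
    (Z : TDom d N') (t : Finset (TDom d (L * N')) × Finset (TBond d M (L * N')))
    (hpos : ∀ Y : TDom d (L * N'), 0 < invTau c ((tsys d (L * N')).dj Y))
    (hhalf : ∀ Y : TDom d (L * N'), invTau c ((tsys d (L * N')).dj Y) ≤ 1 / 2)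
    {Uσ : Set ℂ} {Uτ : TDom d (L * N') → Set ℂ} (hUσ : IsOpen Uσ) (hUτ : ∀ Y, IsOpen (Uτ Y))
    (hUexp : closedBall (0 : ℂ) (Real.exp c.κ₁) ⊆ Uσ)
    (hUtau : ∀ Y : TDom d (L * N'), closedBall (0 : ℂ) ((invTau c ((tsys d (L * N')).dj Y))⁻¹) ⊆ Uτ Y)
    {r : ℝ} (hr : 0 < r) (hr' : r ≤ Real.exp c.κ₁ - 1)
    (hsubτ : ∀ Y, ∀ s ∈ Set.uIcc (0 : ℝ) 1, closedBall (s : ℂ) r ⊆ Uτ Y)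
    (lZ : List (TPt d N')) (hlZ : lZ.Nodup ∧ lZ.toFinset = Z.1 \ tclosure L N' (Z0 M t))
    (lD : List (TDom d (L * N'))) (hlD : lD.Nodup ∧ lD.toFinset = t.1)
    -- the (2.14)-data AT THE REAL COUPLING (b = 1)
    (A : (TPt d N' → ℂ) → Matrix Λ Λ ℂ) (Γ : (TPt d N' → ℂ) → (Λ ⊕ C₀ → ℝ) → (Λ → ℂ))
    {χY₀ χcP : (Λ → ℝ) → ℝ} (hχ0 : ∀ B, 0 ≤ χY₀ B) (hχc0 : ∀ B, 0 ≤ χcP B)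
    (hχe : ∀ B, χY₀ (-B) = χY₀ B) (hχce : ∀ B, χcP (-B) = χcP B) (Dfam : Finset (TDom d (L * N')))
    {V V₀ V₁ : TDom d (L * N') → (Λ → ℝ) → ℂ}
    {C : Matrix Λ Λ ℝ} (hC : C.PosDef) (Γ₀ : Matrix Λ (Λ ⊕ C₀) ℝ)
    (hAhol : ∀ i j, DifferentiableOn ℂ (fun σ => A σ i j) {σ | ∀ j, σ j ∈ Uσ})
    (hχm : Measurable χY₀) (hχcm : Measurable χcP) (hVm : ∀ Y, Measurable (V Y)) (hV₀m : ∀ Y, Measurable (V₀ Y))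
    (hV₁m : ∀ Y, Measurable (V₁ Y)) (hV₀e : ∀ Y B, V₀ Y (-B) = V₀ Y B) (hV₁o : ∀ Y B, V₁ Y (-B) = -V₁ Y B)
    (hAs : ∀ σ : TPt d N' → ℂ, (∀ j, σ j ∈ Uσ) → (A σ).IsSymm)
    (G : (TPt d N' → ℂ) → Matrix Λ (Λ ⊕ C₀) ℂ)
    (hGhol : ∀ i j, DifferentiableOn ℂ (fun σ => G σ i j) {σ | ∀ j, σ j ∈ Uσ})
    (hlin : ∀ σ : TPt d N' → ℂ, (∀ j, σ j ∈ Uσ) → ∀ X : Λ ⊕ C₀ → ℝ, Γ σ X = G σ *ᵥ fun j => (X j : ℂ))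
    -- (2.22); (2.20) for 𝐕, the centre's bound, and the Taylor letters, on the open per-domain τ-region
    {γ₂ rP a₂₀ w w₀ s a₁ w₁ a₂ w₂ ac wc : ℝ} (qP : (Λ → ℝ) → ℝ)
    (h222 : ∀ B, χY₀ B * χcP B ≤ Real.exp (-(γ₂ / 2 * rP ^ 2 * (t.2.card : ℕ)) + γ₂ / 2 * qP B)) (hγ₂ : 0 ≤ γ₂)
    (hqP : ∀ B, qP B ≤ B ⬝ᵥ B) (ha₂₀ : 0 ≤ a₂₀)
    (h220U : ∀ τ : TDom d (L * N') → ℂ, (∀ Y, τ Y ∈ Uτ Y) →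
      ∀ B, ∑ Y ∈ Dfam, ‖τ Y‖ * ‖V Y B‖ ≤ a₂₀ / 2 * (B ⬝ᵥ B) + w)
    (hw₀U : ∀ τ : TDom d (L * N') → ℂ, (∀ Y, τ Y ∈ Uτ Y) → ∀ B, ∑ Y ∈ Dfam, ‖τ Y‖ * ‖V₀ Y B‖ ≤ w₀)
    (hs : 0 ≤ s) (ha₁ : 0 ≤ a₁) (hw₁ : 0 ≤ w₁) (ha₂ : 0 ≤ a₂) (hw₂ : 0 ≤ w₂)
    (h1U : ∀ τ : TDom d (L * N') → ℂ, (∀ Y, τ Y ∈ Uτ Y) →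
      ∀ B, ∑ Y ∈ Dfam, ‖τ Y‖ * ‖V Y B - V₀ Y B‖ ≤ s * (a₁ / 2 * (B ⬝ᵥ B) + w₁))
    (h2U : ∀ τ : TDom d (L * N') → ℂ, (∀ Y, τ Y ∈ Uτ Y) →
      ∀ B, ∑ Y ∈ Dfam, ‖τ Y‖ * ‖V Y B - V₀ Y B - V₁ Y B‖ ≤ s ^ 2 * (a₂ / 2 * (B ⬝ᵥ B) + w₂))
    (hac₀ : a₂₀ ≤ ac) (hac₂ : a₂ ≤ ac) (hac₁ : (1 + s) * a₁ ≤ ac)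
    (hwc : Real.exp w₀ * (Real.exp w₂ + 2 * Real.exp ((1 + s) * w₁)) ≤ Real.exp wc)
    -- bonds located on the torus `UT Nf`
    (locΛ : Λ → UT Nf) (locN : Λ ⊕ C₀ → UT Nf) {m : ℕ}
    (hfibΛ : ∀ x : UT Nf, (Finset.univ.filter fun i => locΛ i = x).card ≤ m)
    (hfibN : ∀ x : UT Nf, (Finset.univ.filter fun j => locN j = x).card ≤ m)
    -- rates and the letters AT b = 1 (+ K_E)
    {kap kap' kap'' θ θE θΓ θC KG KΓ KCs K₀ KE : ℝ} (hkap'' : 0 < kap'') (hk1 : kap'' < kap') (hk2 : kap' < kap)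
    (hθE : 0 ≤ θE) (hθΓ : 0 ≤ θΓ) (hθC : 0 ≤ θC) (hKG : 0 ≤ KG) (hKΓ : 0 ≤ KΓ) (hKCs : 0 ≤ KCs) (hK₀ : 0 ≤ K₀)
    (hKE : 0 ≤ KE)
    (hG : ∀ σ : TPt d N' → ℂ, (∀ j, σ j ∈ Uσ) →
      ∀ b j, ‖G σ b j‖ ≤ KG * Real.exp (-(kap * tdist1 Nf (locΛ b) (locN j))))
    (hΓ₀ : ∀ b j, ‖Γ₀ b j‖ ≤ KΓ * Real.exp (-(kap * tdist1 Nf (locΛ b) (locN j))))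
    (hCs : ∀ σ : TPt d N' → ℂ, (∀ j, σ j ∈ Uσ) →
      ∀ b b', ‖(A σ)⁻¹ b b'‖ ≤ KCs * Real.exp (-(kap * tdist1 Nf (locΛ b) (locΛ b'))))
    (hC216 : ∀ b b', ‖C b b'‖ ≤ K₀ * Real.exp (-(kap * tdist1 Nf (locΛ b) (locΛ b'))))
    (hCE : ∀ b b', ‖(C⁻¹.map (algebraMap ℝ ℂ)) b b'‖ ≤ KE * Real.exp (-(kap * tdist1 Nf (locΛ b) (locΛ b'))))
    (hdΓ : ∀ σ : TPt d N' → ℂ, (∀ j, σ j ∈ Uσ) →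
      ∀ b j, ‖(G σ - Γ₀.map (algebraMap ℝ ℂ)) b j‖ ≤ θΓ * Real.exp (-(kap * tdist1 Nf (locΛ b) (locN j))))
    (hdC : ∀ σ : TPt d N' → ℂ, (∀ j, σ j ∈ Uσ) →
      ∀ b b', ‖((A σ)⁻¹ - C.map (algebraMap ℝ ℂ)) b b'‖
        ≤ θC * Real.exp (-(kap * tdist1 Nf (locΛ b) (locΛ b'))))
    (hdE : ∀ σ : TPt d N' → ℂ, (∀ j, σ j ∈ Uσ) →
      ∀ b b', ‖(A σ - C⁻¹.map (algebraMap ℝ ℂ)) b b'‖ ≤ θE * Real.exp (-(kap * tdist1 Nf (locΛ b) (locΛ b'))))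
    {ρb KG' KCs' θΓ' θC' θE' : ℝ} (hρb1 : ρb < 1)
    (hKG' : (1 + ρb) * KG ≤ KG') (hKCs' : ((1 - ρb) ^ 2)⁻¹ * KCs ≤ KCs')
    (hθΓ' : θΓ + ρb * KG ≤ θΓ') (hθC' : θC + ρb * (2 + ρb) * ((1 - ρb) ^ 2)⁻¹ * KCs ≤ θC')
    (hθE' : θE + ρb * (2 + ρb) * (θE + KE) ≤ θE')
    -- the capstone's numeric conditions in the primed letters, at the master rate γ₂ + a_c, with w_c
    (hθEle : θE' ≤ θ) (hθΓle : θΓ' ≤ θ)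
    (hθR1le : (m * (1 + 2 / (kap - kap')) ^ ν) * (m * (1 + 2 / (kap' - kap'')) ^ ν)
      * (θΓ' * KCs' * KG' + KΓ * θC' * KG' + KΓ * K₀ * θΓ') ≤ θ)
    (hsmallKθ : K₀ * (m * (1 + 2 / kap) ^ ν) * (θ * (m * (1 + 2 / kap'') ^ ν)) < 1)
    {cE g : ℝ} (hc0 : 0 ≤ cE) (hc : ∀ k, hC.1.eigenvalues k ≤ cE)
    (hαc : (2 * (θ * (m * (1 + 2 / kap'') ^ ν)) + (γ₂ + ac)) * cE ≤ 1 / 2) (hg : 0 ≤ g)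
    (hΓq : ∀ X : Λ ⊕ C₀ → ℝ, (Γ₀ *ᵥ X) ⬝ᵥ (C *ᵥ (Γ₀ *ᵥ X)) ≤ g * (X ⬝ᵥ X))
    (hsmall : (2 * (θ * (m * (1 + 2 / kap'') ^ ν)) + (γ₂ + ac)) * (1 + 2 * cE * g) ≤ 1 / 2)
    {a a₅ : ℝ} (hPa : a ≤ γ₂ * rP ^ 2)
    (hvol : 2 * (K₀ * (m * (1 + 2 / kap) ^ ν) * (θ * (m * (1 + 2 / kap'') ^ ν))
              * (1 + (1 - K₀ * (m * (1 + 2 / kap) ^ ν) * (θ * (m * (1 + 2 / kap'') ^ ν)))⁻¹) / 2)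
          * (Fintype.card Λ : ℝ)
        + wc + (2 * (θ * (m * (1 + 2 / kap'') ^ ν)) + (γ₂ + ac)) * cE * (Fintype.card Λ : ℝ)
        + (2 * (θ * (m * (1 + 2 / kap'') ^ ν)) + (γ₂ + ac)) * (1 + 2 * cE * g) * (Fintype.card (Λ ⊕ C₀) : ℝ)
        ≤ a₅ * ((Z.1).card : ℝ))
    {b : ℂ} (hb : b ∈ ball (1 : ℂ) ρb) :
    ‖term214 r lZ lD (core214 (fun σ => b ^ 2 • A σ) (fun σ X => b • Γ σ X)
          (F214 t.2.card χY₀ χcP Dfam V)) 0 0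
        - term214 r lZ lD (core214 (fun σ => b ^ 2 • A σ) (fun σ X => b • Γ σ X)
          (F214 t.2.card χY₀ χcP Dfam V₀)) 0 0‖ ≤
      s ^ 2 * (weight L M c Z a t * Real.exp (a₅ * ((Z.1).card : ℝ))) := by
  obtain ⟨hlZ1, hlZ2⟩ := hlZ
  obtain ⟨hlD1, hlD2⟩ := hlD
  have hρb0 : 0 ≤ ρb := rad_nonneg_of_mem_ball hb
  have hexp : ∀ x : ℝ, 0 ≤ Real.exp x := fun x => (Real.exp_pos x).le
  have hθ : 0 ≤ θ := le_trans (le_trans (by positivity) hθE') hθEle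
  have hkk : kap'' ≤ kap := (hk1.trans hk2).le
  have hac0 : 0 ≤ ac := ha₂₀.trans hac₀
  -- the τ-radii `|τ(Y)| = (invTau …)⁻¹ ≥ 2`, the σ-discs, membership of the polydiscs in the regions
  set Rτ : TDom d (L * N') → ℝ := fun Y => (invTau c ((tsys d (L * N')).dj Y))⁻¹ with hRτ
  have hR2 : ∀ Y, (2 : ℝ) ≤ Rτ Y := fun Y => by
    rw [hRτ]; dsimp only; rw [le_inv_comm₀ (by norm_num) (hpos Y)]; simpa [one_div] using hhalf Y
  have hsubσ : ∀ x ∈ Set.uIcc (0 : ℝ) 1, closedBall (x : ℂ) r ⊆ Uσ :=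
    fun x hx => (closedBall_subset_closedBall_of_mem_uIcc hr' hx).trans hUexp
  have h0σ : (0 : ℂ) ∈ Uσ := by simpa using hsubσ 0 (by simp) (mem_closedBall_self hr.le)
  have h0τ : ∀ Y, (0 : ℂ) ∈ Uτ Y := fun Y => by simpa using hsubτ Y 0 (by simp) (mem_closedBall_self hr.le)
  have hσU : ∀ σ : TPt d N' → ℂ, (∀ j, ‖σ j‖ ≤ Real.exp c.κ₁) → ∀ j, σ j ∈ Uσ :=
    fun σ hσ j => hUexp (mem_closedBall_zero_iff.2 (hσ j))
  have hτU : ∀ τ : TDom d (L * N') → ℂ, (∀ Y, ‖τ Y‖ ≤ Rτ Y) → ∀ Y, τ Y ∈ Uτ Y :=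
    fun τ hτ Y => hUtau Y (mem_closedBall_zero_iff.2 (hτ Y))
  -- the dilated kernels and their transported letters at this `b`
  set A' : (TPt d N' → ℂ) → Matrix Λ Λ ℂ := fun σ => b ^ 2 • A σ with hA'
  set G' : (TPt d N' → ℂ) → Matrix Λ (Λ ⊕ C₀) ℂ := fun σ => b • G σ with hG'def
  set Γ' : (TPt d N' → ℂ) → (Λ ⊕ C₀ → ℝ) → (Λ → ℂ) := fun σ X => b • Γ σ X with hΓ'
  have hlin' : ∀ σ : TPt d N' → ℂ, (∀ j, σ j ∈ Uσ) → ∀ X : Λ ⊕ C₀ → ℝ,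
      Γ' σ X = G' σ *ᵥ fun j => (X j : ℂ) := fun σ hσ X => by
    simp only [hΓ', hG'def]; rw [hlin σ hσ X, Matrix.smul_mulVec]
  have hAs' : ∀ σ : TPt d N' → ℂ, (∀ j, σ j ∈ Uσ) → (A' σ).IsSymm := fun σ hσ => (hAs σ hσ).smul _
  have hAhol' : ∀ i j, DifferentiableOn ℂ (fun σ => A' σ i j) {σ | ∀ j, σ j ∈ Uσ} := fun i j => by
    simpa only [hA', Matrix.smul_apply, smul_eq_mul] using (hAhol i j).const_mul (b ^ 2)
  have hGhol' : ∀ i j, DifferentiableOn ℂ (fun σ => G' σ i j) {σ | ∀ j, σ j ∈ Uσ} := fun i j => by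
    simpa only [hG'def, Matrix.smul_apply, smul_eq_mul] using (hGhol i j).const_mul b
  have hGl : ∀ σ : TPt d N' → ℂ, (∀ j, σ j ∈ Uσ) →
      ∀ i j, ‖G' σ i j‖ ≤ KG' * Real.exp (-(kap * tdist1 Nf (locΛ i) (locN j))) := fun σ hσ i j =>
    (smul_entry_le (hG σ hσ) hb i j).trans (mul_le_mul_of_nonneg_right hKG' (hexp _))
  have hCsl : ∀ σ : TPt d N' → ℂ, (∀ j, σ j ∈ Uσ) →
      ∀ i j, ‖(A' σ)⁻¹ i j‖ ≤ KCs' * Real.exp (-(kap * tdist1 Nf (locΛ i) (locΛ j))) := fun σ hσ i j =>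
    (inv_sq_smul_entry_le (hCs σ hσ) hρb1 hb i j).trans (mul_le_mul_of_nonneg_right hKCs' (hexp _))
  have hdΓl : ∀ σ : TPt d N' → ℂ, (∀ j, σ j ∈ Uσ) →
      ∀ i j, ‖(G' σ - Γ₀.map (algebraMap ℝ ℂ)) i j‖ ≤ θΓ' * Real.exp (-(kap * tdist1 Nf (locΛ i) (locN j))) :=
    fun σ hσ i j => (smul_sub_entry_le (hG σ hσ) (hdΓ σ hσ) hb i j).trans (mul_le_mul_of_nonneg_right hθΓ' (hexp _))
  have hdCl : ∀ σ : TPt d N' → ℂ, (∀ j, σ j ∈ Uσ) →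
      ∀ i j, ‖((A' σ)⁻¹ - C.map (algebraMap ℝ ℂ)) i j‖
        ≤ θC' * Real.exp (-(kap * tdist1 Nf (locΛ i) (locΛ j))) := fun σ hσ i j =>
    (inv_sq_smul_sub_entry_le (hCs σ hσ) (hdC σ hσ) hρb1 hb i j).trans (mul_le_mul_of_nonneg_right hθC' (hexp _))
  have hdEl : ∀ σ : TPt d N' → ℂ, (∀ j, σ j ∈ Uσ) →
      ∀ i j, ‖(A' σ - C⁻¹.map (algebraMap ℝ ℂ)) i j‖
        ≤ θE' * Real.exp (-(kap * tdist1 Nf (locΛ i) (locΛ j))) := fun σ hσ i j =>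
    (sq_smul_sub_entry_le hCE (hdE σ hσ) hb i j).trans (mul_le_mul_of_nonneg_right hθE' (hexp _))
  have hA' : ∀ σ : TPt d N' → ℂ, (∀ j, σ j ∈ Uσ) → ((A' σ).map Complex.re).PosDef := by
    intro σ hσ
    have h216E : ∀ i j, ‖(A' σ - C⁻¹.map (algebraMap ℝ ℂ)) i j‖
        ≤ θ * Real.exp (-(kap'' * tdist1 Nf (locΛ i) (locΛ j))) := fun i j =>
      (entry_bound_mono_rate (weightHyp_tdist1 (N := Nf)) (le_trans (by positivity) hθE') hkk locΛ locΛ (hdEl σ hσ)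
        i j).trans (mul_le_mul_of_nonneg_right hθEle (hexp _))
    refine posDef_re_of_form (hAs' σ hσ) hC hc
      (hR2_of_entrywise (weightHyp_tdist1 (N := Nf)) tdist1_symm kc_tdist1 hθ hkap'' locΛ hfibΛ h216E) ?_
    exact theta_mul_lt_one hγ₂ hac0 hc0 hαc
  -- non-negativity of the primed letters
  have hθE'0 : 0 ≤ θE' := le_trans (by positivity) hθE'
  have hθΓ'0 : 0 ≤ θΓ' := le_trans (by positivity) hθΓ'
  have hθC'0 : 0 ≤ θC' := le_trans (by positivity) hθC'
  have hKG'0 : 0 ≤ KG' := le_trans (by positivity) hKG'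
  have hKCs'0 : 0 ≤ KCs' := le_trans (by positivity) hKCs'
  -- the Gaussian bounds of the two last lines at the MASTER rate (for separate holomorphy)
  set KP : ℝ := Real.exp (-(γ₂ / 2 * rP ^ 2 * (t.2.card : ℕ))) with hKP
  have hBB : ∀ B : Λ → ℝ, 0 ≤ B ⬝ᵥ B := fun B => Finset.sum_nonneg fun i _ => mul_self_nonneg (B i)
  have hθ'c : 0 ≤ θ * (m * (1 + 2 / kap'') ^ ν) := by positivity
  -- the numeric conditions ∕ Gaussian factors at smaller rates follow from the master ones
  have hmonoc : ∀ {a' : ℝ}, a' ≤ γ₂ + ac →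
      (2 * (θ * (m * (1 + 2 / kap'') ^ ν)) + a') * cE ≤ 1 / 2 := fun {a'} ha' =>
    le_trans (mul_le_mul_of_nonneg_right (by linarith only [ha']) hc0) hαc
  have hmonos : ∀ {a' : ℝ}, a' ≤ γ₂ + ac →
      (2 * (θ * (m * (1 + 2 / kap'') ^ ν)) + a') * (1 + 2 * cE * g) ≤ 1 / 2 := fun {a'} ha' =>
    le_trans (mul_le_mul_of_nonneg_right (by linarith only [ha']) (by positivity)) hsmall
  have hmono : ∀ (B : Λ → ℝ) {a' : ℝ}, a' ≤ ac →
      Real.exp ((γ₂ + a') / 2 * (B ⬝ᵥ B)) ≤ Real.exp ((γ₂ + ac) / 2 * (B ⬝ᵥ B)) := fun B a' ha =>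
    Real.exp_le_exp.2 (mul_le_mul_of_nonneg_right (by linarith only [ha]) (hBB B))
  -- the σ-slot of both X-integrals, for τ in the per-domain region
  have hFb : ∀ τ : TDom d (L * N') → ℂ, (∀ Y, τ Y ∈ Uτ Y) → ∀ B,
      ‖F214 t.2.card χY₀ χcP Dfam V τ B‖ ≤ (KP * Real.exp w) * Real.exp ((γ₂ + ac) / 2 * (B ⬝ᵥ B)) := fun τ hτ B => by
    have h := norm_F214_le t.2.card χY₀ χcP Dfam V τ qP B (hχ0 B) (hχc0 B) (h222 B) hγ₂ (hqP B) (h220U τ hτ B)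
    rw [hKP, ← Real.exp_add]
    exact h.trans (mul_le_mul_of_nonneg_left (hmono B hac₀) (hexp _))
  have h220₀ : ∀ τ : TDom d (L * N') → ℂ, (∀ Y, τ Y ∈ Uτ Y) → ∀ B,
      ∑ Y ∈ Dfam, ‖τ Y‖ * ‖V₀ Y B‖ ≤ 0 / 2 * (B ⬝ᵥ B) + w₀ := fun τ hτ B => by
    rw [zero_div, zero_mul, zero_add]; exact hw₀U τ hτ B
  have hF₀b : ∀ τ : TDom d (L * N') → ℂ, (∀ Y, τ Y ∈ Uτ Y) → ∀ B,
      ‖F214 t.2.card χY₀ χcP Dfam V₀ τ B‖ ≤ (KP * Real.exp w₀) * Real.exp ((γ₂ + ac) / 2 * (B ⬝ᵥ B)) := fun τ hτ B => by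
    have h := norm_F214_le t.2.card χY₀ χcP Dfam V₀ τ qP B (hχ0 B) (hχc0 B) (h222 B) hγ₂ (hqP B) (h220₀ τ hτ B)
    rw [hKP, ← Real.exp_add]
    exact h.trans (mul_le_mul_of_nonneg_left (hmono B hac0) (hexp _))
  have hΨσW : ∀ (W : TDom d (L * N') → (Λ → ℝ) → ℂ) (_ : ∀ Y, Measurable (W Y)) {Kw : ℝ} (_ : 0 ≤ Kw)
      (_ : ∀ τ : TDom d (L * N') → ℂ, (∀ Y, τ Y ∈ Uτ Y) → ∀ B,
        ‖F214 t.2.card χY₀ χcP Dfam W τ B‖ ≤ Kw * Real.exp ((γ₂ + ac) / 2 * (B ⬝ᵥ B)))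
      (τ : TDom d (L * N') → ℂ), (∀ Y, τ Y ∈ Uτ Y) →
      SepHolOn Uσ (fun σ => core214 A' Γ' (F214 t.2.card χY₀ χcP Dfam W) σ τ) := fun W hWm {Kw} hKw hWb τ hτ =>
    sepHolOn_core214_sigma_of_primitives (weightHyp_tdist1 (N := Nf)) tdist1_symm kc_tdist1 kc_l1_nonneg hUσ A' Γ' G'
      hAhol' hGhol' hAs' hA' hlin' (F214 t.2.card χY₀ χcP Dfam W) τ
      (measurable_F214 t.2.card hχm hχcm Dfam hWm τ).stronglyMeasurable hKw (add_nonneg hγ₂ hac0) (hWb τ hτ)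
      hC Γ₀ locΛ locN hfibΛ hfibN hkap'' hk1 hk2 hθE'0 hθΓ'0 hθC'0 hKG'0 hKΓ hKCs'0 hK₀ hθEle hθΓle hθR1le hGl hΓ₀ hCsl
      hC216 hdΓl hdCl hdEl hsmallKθ hc0 hc hαc hΓq hsmall
  have hΨσ := hΨσW V hVm (by positivity) hFb
  have hΨ₀σ := hΨσW V₀ hV₀m (by positivity) hF₀b
  -- the τ-slot of both X-integrals, for σ in the open σ-polydisc
  have hΨτW : ∀ (W : TDom d (L * N') → (Λ → ℝ) → ℂ) (_ : ∀ Y, Measurable (W Y)) {a' w' : ℝ} (_ : 0 ≤ a')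
      (_ : a' ≤ ac)
      (_ : ∀ τ : TDom d (L * N') → ℂ, (∀ Y, τ Y ∈ Uτ Y) → ∀ B,
        ∑ Y ∈ Dfam, ‖τ Y‖ * ‖W Y B‖ ≤ a' / 2 * (B ⬝ᵥ B) + w')
      (σ : TPt d N' → ℂ), (∀ j, σ j ∈ Uσ) →
      SepHolOnPoly Uτ (fun τ => core214 A' Γ' (F214 t.2.card χY₀ χcP Dfam W) σ τ) :=
      fun W hWm {a' w'} ha'0 ha' h220W σ hσ =>
    sepHolOnPoly_core214_tau_of_primitives (weightHyp_tdist1 (N := Nf)) tdist1_symm kc_tdist1 kc_l1_nonneg hUτ A' Γ' G' σ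
      (hAs' σ hσ) (hA' σ hσ) (hlin' σ hσ) t.2.card hχm hχcm hχ0 hχc0 Dfam hWm qP h222 hγ₂ hqP ha'0 h220W hC Γ₀ locΛ locN
      hfibΛ hfibN hkap'' hk1 hk2 hθE'0 hθΓ'0 hθC'0 hKG'0 hKΓ hKCs'0 hK₀ hθEle hθΓle hθR1le (hGl σ hσ) hΓ₀ (hCsl σ hσ) hC216
      (hdΓl σ hσ) (hdCl σ hσ) (hdEl σ hσ) hsmallKθ hc0 hc (hmonoc (by linarith only [ha'])) hΓq
      (hmonos (by linarith only [ha']))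
  have hΨτ := hΨτW V hVm ha₂₀ hac₀ h220U
  have hΨ₀τ := hΨτW V₀ hV₀m le_rfl hac0 h220₀
  -- the uniform centred bound on the closed polydiscs (§2 at the transported letters)
  set Kcen : ℝ := Real.exp (2 * (K₀ * (m * (1 + 2 / kap) ^ ν) * (θ * (m * (1 + 2 / kap'') ^ ν))
              * (1 + (1 - K₀ * (m * (1 + 2 / kap) ^ ν) * (θ * (m * (1 + 2 / kap'') ^ ν)))⁻¹) / 2) * Fintype.card Λ)
          * (Real.exp wc * Real.exp (-(γ₂ / 2 * rP ^ 2 * (t.2.card : ℕ))))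
          * (Real.exp ((2 * (θ * (m * (1 + 2 / kap'') ^ ν)) + (γ₂ + ac)) * cE * Fintype.card Λ)
            * Real.exp ((2 * (θ * (m * (1 + 2 / kap'') ^ ν)) + (γ₂ + ac)) * (1 + 2 * cE * g) * Fintype.card (Λ ⊕ C₀)))
    with hKcen
  have hK : ∀ (σ : TPt d N' → ℂ) (τ : TDom d (L * N') → ℂ), (∀ j, ‖σ j‖ ≤ Real.exp c.κ₁) → (∀ Y, ‖τ Y‖ ≤ Rτ Y) →
      ‖core214 A' Γ' (F214 t.2.card χY₀ χcP Dfam V) σ τ - core214 A' Γ' (F214 t.2.card χY₀ χcP Dfam V₀) σ τ‖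
        ≤ s ^ 2 * Kcen := by
    intro σ τ hσ hτ
    have hσ' := hσU σ hσ
    have hτ' := hτU τ hτ
    exact norm_core214_sub_le_K_centred_of_primitives (weightHyp_tdist1 (N := Nf)) tdist1_symm kc_tdist1 kc_l1_nonneg
      (hAs' σ hσ') (hA' σ hσ') (hlin' σ hσ') hC Γ₀ t.2.card hχm hχcm hχ0 hχc0 hχe hχce Dfam hVm hV₀m hV₁m hV₀e hV₁o τ qP
      h222 hγ₂ hqP (h220U τ hτ') ha₂₀ (hw₀U τ hτ') hs ha₁ hw₁ ha₂ hw₂ (h1U τ hτ') (h2U τ hτ') hac₀ hac₂ hac₁ hwc locΛ locN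
      hfibΛ hfibN hkap'' hk1 hk2 hθE'0 hθΓ'0 hθC'0 hKG'0 hKΓ hKCs'0 hK₀ hθEle hθΓle hθR1le (hGl σ hσ') hΓ₀ (hCsl σ hσ')
      hC216 (hdΓl σ hσ') (hdCl σ hσ') (hdEl σ hσ') hsmallKθ hc0 hc hαc hg hΓq hsmall
  -- the Cauchy layer on the DIFFERENCE of the two X-integrals
  have hDσ : ∀ τ : TDom d (L * N') → ℂ, (∀ Y, τ Y ∈ Uτ Y) → SepHolOn Uσ (fun σ =>
      core214 A' Γ' (F214 t.2.card χY₀ χcP Dfam V) σ τ - core214 A' Γ' (F214 t.2.card χY₀ χcP Dfam V₀) σ τ) :=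
    fun τ hτ i p hp => (hΨσ τ hτ i p hp).sub (hΨ₀σ τ hτ i p hp)
  have hDτ : ∀ σ : TPt d N' → ℂ, (∀ j, σ j ∈ Uσ) → SepHolOnPoly Uτ (fun τ =>
      core214 A' Γ' (F214 t.2.card χY₀ χcP Dfam V) σ τ - core214 A' Γ' (F214 t.2.card χY₀ χcP Dfam V₀) σ τ) :=
    fun σ hσ i p hp => (hΨτ σ hσ i p hp).sub (hΨ₀τ σ hσ i p hp)
  have hmain := norm_term214_le_215_polyτ hκ₁ Rτ hR2 hUσ hUτ hUexp (fun Y => hUtau Y) hr hr' hsubτ hDσ hDτ hK hlZ1 hlD1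
    (σ₀ := 0) (fun _ => by simp) (τ₀ := 0) (fun _ => by simp)
  -- identification: the term of the difference is the difference of the terms
  have hsub := term214_sub_of_sepHolOnPoly hUσ hUτ hr hsubσ hsubτ hΨσ hΨτ hΨ₀σ hΨ₀τ hlZ1 hlD1
    (σ₀ := 0) (fun _ => h0σ) (τ₀ := 0) (fun Y => h0τ Y)
  rw [← hsub]
  refine hmain.trans ?_
  -- `|lZ| = #blocks(Z∖Z′₀)` and `2/|τ(Y)| = α₆ε₂e^{−(1−3δ)κd_k(Y)}`
  have hlen : ((lZ.length : ℕ) : ℝ) = ((Z.1 \ tclosure L N' (Z0 M t)).card : ℝ) := by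
    rw [← List.toFinset_card_of_nodup hlZ1, hlZ2]
  have hprod : (∏ Y ∈ lD.toFinset, 2 * (Rτ Y)⁻¹) =
      ∏ Y ∈ t.1, c.α₆ * c.eps2 * Real.exp (-((1 - 3 * c.δ) * c.κ * (tsys d (L * N')).dj Y)) := by
    rw [hlD2]
    refine Finset.prod_congr rfl fun Y _ => ?_
    rw [hRτ]; dsimp only
    rw [inv_inv, two_mul_invTau_eq c hα₆]
    ring_nf
  -- the volume factors and the |P|-rate (p. 17)
  have hP0 : (0 : ℝ) ≤ (t.2.card : ℕ) := Nat.cast_nonneg _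
  have hPrate : -(γ₂ / 2 * rP ^ 2 * (t.2.card : ℕ)) ≤ -(a / 2 * (t.2.card : ℝ)) := by
    have := mul_le_mul_of_nonneg_right hPa hP0
    linarith only [this]
  have hGauss : Kcen ≤ Real.exp (-(a / 2 * (t.2.card : ℝ))) * Real.exp (a₅ * ((Z.1).card : ℝ)) := by
    rw [hKcen, ← Real.exp_add, ← Real.exp_add, ← Real.exp_add, ← Real.exp_add, ← Real.exp_add, Real.exp_le_exp]
    linarith only [hvol, hPrate]
  have hF12 : 0 ≤ Real.exp (-(c.κ₁ - 1) * lZ.length) * ∏ Y ∈ lD.toFinset, 2 * (Rτ Y)⁻¹ :=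
    mul_nonneg (Real.exp_nonneg _)
      (Finset.prod_nonneg fun Y _ => mul_nonneg zero_le_two (inv_nonneg.2 (by linarith only [hR2 Y])))
  calc Real.exp (-(c.κ₁ - 1) * lZ.length) * (∏ Y ∈ lD.toFinset, 2 * (Rτ Y)⁻¹) * (s ^ 2 * Kcen)
      ≤ Real.exp (-(c.κ₁ - 1) * lZ.length) * (∏ Y ∈ lD.toFinset, 2 * (Rτ Y)⁻¹)
          * (s ^ 2 * (Real.exp (-(a / 2 * (t.2.card : ℝ))) * Real.exp (a₅ * ((Z.1).card : ℝ)))) :=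
        mul_le_mul_of_nonneg_left (mul_le_mul_of_nonneg_left hGauss (sq_nonneg _)) hF12
    _ = s ^ 2 * (weight L M c Z a t * Real.exp (a₅ * ((Z.1).card : ℝ))) := by
        rw [hprod, weight, ← hlen]
        ring_nf

end Torus

end Literature.MathematicalPhysics.QuantumFieldTheory.Balaban1983to89.B13Bound226Centred

end
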